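import Mathlib
import HarnessLib

/-!
# An odd square root of unity in `E ⊗_F k₁` for a field involution whose conjugates lie in `E`

Let `k₁ / F` be a finite extension of fields and `E / F` a field extension. The evaluation map

  `(Algebra.TensorProduct.lift (Algebra.ofId E ((k₁ →ₐ[F] E) → E))
      (AlgHom.pi fun σ : k₁ →ₐ[F] E => σ) (fun _ _ => Commute.all _ _)) : E ⊗_F k₁ → E^{Hom_F(k₁, E)}`, `a ⊗ x ↦ (a · σ(x))_σ`

is an `E`-algebra homomorphism (below it is always the explicit term
`Algebra.TensorProduct.lift (Algebra.ofId E _) (AlgHom.pi fun σ ↦ σ) _`, written out in every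
statement; no definition or notation is introduced). We prove:

* `evalEmb_surjective` — `(Algebra.TensorProduct.lift (Algebra.ofId E ((k₁ →ₐ[F] E) → E))
      (AlgHom.pi fun σ : k₁ →ₐ[F] E => σ) (fun _ _ => Commute.all _ _))` is ALWAYS surjective (Dedekind's independence of the distinct
  embeddings `σ`, `linearIndependent_toLinearMap`, read through a linear functional vanishing on
  the range);
* `evalEmb_injective` — `(Algebra.TensorProduct.lift (Algebra.ofId E ((k₁ →ₐ[F] E) → E))
      (AlgHom.pi fun σ : k₁ →ₐ[F] E => σ) (fun _ _ => Commute.all _ _))` is injective, hence bijective, as soon as `E` contains all the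
  conjugates of `k₁`, i.e. `#Hom_F(k₁, E) = [k₁ : F]` (dimension count); under `Normal F E` and
  one embedding `k₁ →ₐ[F] E` this cardinality holds (`card_algHom_eq_finrank_of_normal`);
* `evalEmb_map_conj` — for `c : k₁ →ₐ[F] k₁`, `(Algebra.TensorProduct.lift (Algebra.ofId E ((k₁ →ₐ[F] E) → E))
      (AlgHom.pi fun σ : k₁ →ₐ[F] E => σ) (fun _ _ => Commute.all _ _)) ((1 ⊗ c) z) σ = (Algebra.TensorProduct.lift (Algebra.ofId E ((k₁ →ₐ[F] E) → E))
      (AlgHom.pi fun σ : k₁ →ₐ[F] E => σ) (fun _ _ => Commute.all _ _)) z (σ ∘ c)`: an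
  `F`-endomorphism of `k₁` acts on the embedding side by precomposition;
* `exists_sign_of_involutive` — a fixed-point-free involution `π` of a finite type admits an odd
  sign function `ε` (`ε ∘ π = -ε`, `ε² = 1`);
* `exists_sq_eq_one_map_eq_neg` — **main**: if `c` is a non-trivial involution of `k₁` over `F`
  and `#Hom_F(k₁, E) = [k₁ : F]`, there is `u ∈ E ⊗_F k₁` with `u² = 1` and `(1 ⊗ c) u = -u`
  (namely `u = (Algebra.TensorProduct.lift (Algebra.ofId E ((k₁ →ₐ[F] E) → E))
      (AlgHom.pi fun σ : k₁ →ₐ[F] E => σ) (fun _ _ => Commute.all _ _))⁻¹ ε` for an odd sign function `ε` with respect to `σ ↦ σ ∘ c`, which is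
  fixed-point-free because `c ≠ 1`); equivalently `f = (1 + u)/2` is an idempotent exchanged with
  its complement by `1 ⊗ c`;
* `exists_sq_eq_one_map_eq_neg_of_normal` — the same under `[Normal F E]` and an embedding
  `k₁ →ₐ[F] E`.

Pushed forward along any `i : k₁ →ₐ[F] K` intertwining `c` with an endomorphism `ρ` of a
commutative `F`-algebra `K` (`ρ ∘ i = i ∘ c`), `u` becomes an element of `E ⊗_F K` with
`u² = 1`, `(1 ⊗ ρ) u = -u` (`exists_sq_eq_one_map_eq_neg_of_intertwines`); with
`Summit.HodgeConjecture.CorCM.RMuNorm.exists_isUnit_mul_map_eq_of_sq_eq_one`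
(`CorCM/RMuNormFixedUnits.lean`) this makes every `(1 ⊗ ρ)`-fixed unit of `E ⊗_F K` a norm
`a · (1 ⊗ ρ) a` — see `CorCM/RMuNormHermitianUnits.lean` for the CM-field / [Liu 2021] reading
(cell pub-hodgecm2, lane RMU-NORM). See also
`Literature/NumberTheory/Automorphic/Liu2021/Def45RMuGalois.lean` (seat hcmisog-isog-2) for the
Liu-level statement. Standard field theory throughout (placed under the cell's `CorCM/` tree as
cell mathematics). [folklore]
-/

open scoped TensorProduct

namespace Summit.HodgeConjecture.CorCM.RMuNorm

open Module Algebra.TensorProduct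

section Eval

variable {F k₁ E : Type*} [Field F] [Field k₁] [Field E] [Algebra F k₁] [Algebra F E]

/-- `(Algebra.TensorProduct.lift (Algebra.ofId E ((k₁ →ₐ[F] E) → E))
      (AlgHom.pi fun σ : k₁ →ₐ[F] E => σ) (fun _ _ => Commute.all _ _)) (a ⊗ x) σ = a · σ x`. [folklore] -/
theorem evalEmb_tmul (a : E) (x : k₁) (σ : k₁ →ₐ[F] E) : (Algebra.TensorProduct.lift (Algebra.ofId E ((k₁ →ₐ[F] E) → E))
      (AlgHom.pi fun σ : k₁ →ₐ[F] E => σ) (fun _ _ => Commute.all _ _)) (a ⊗ₜ[F] x) σ = a * σ x := by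
  rw [Algebra.TensorProduct.lift_tmul, Pi.mul_apply, AlgHom.pi_apply]
  rfl

/-- An `F`-endomorphism `c` of `k₁` acts on the embedding side by precomposition:
`(Algebra.TensorProduct.lift (Algebra.ofId E ((k₁ →ₐ[F] E) → E))
      (AlgHom.pi fun σ : k₁ →ₐ[F] E => σ) (fun _ _ => Commute.all _ _)) ((1 ⊗ c) z) σ = (Algebra.TensorProduct.lift (Algebra.ofId E ((k₁ →ₐ[F] E) → E))
      (AlgHom.pi fun σ : k₁ →ₐ[F] E => σ) (fun _ _ => Commute.all _ _)) z (σ ∘ c)`. [folklore] -/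
theorem evalEmb_map_conj (c : k₁ →ₐ[F] k₁) (z : E ⊗[F] k₁) (σ : k₁ →ₐ[F] E) :
    (Algebra.TensorProduct.lift (Algebra.ofId E ((k₁ →ₐ[F] E) → E))
      (AlgHom.pi fun σ : k₁ →ₐ[F] E => σ) (fun _ _ => Commute.all _ _)) (Algebra.TensorProduct.map (AlgHom.id E E) c z) σ = (Algebra.TensorProduct.lift (Algebra.ofId E ((k₁ →ₐ[F] E) → E))
      (AlgHom.pi fun σ : k₁ →ₐ[F] E => σ) (fun _ _ => Commute.all _ _)) z (σ.comp c) := by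
  induction z using TensorProduct.induction_on with
  | zero => simp only [map_zero, Pi.zero_apply]
  | tmul a x => rw [Algebra.TensorProduct.map_tmul, evalEmb_tmul, evalEmb_tmul]; rfl
  | add z w hz hw => simp only [map_add, Pi.add_apply, hz, hw]

/-- **`(Algebra.TensorProduct.lift (Algebra.ofId E ((k₁ →ₐ[F] E) → E))
      (AlgHom.pi fun σ : k₁ →ₐ[F] E => σ) (fun _ _ => Commute.all _ _))` is surjective** (for any extension `E/F`): otherwise a non-zero `E`-linear functional
`φ = ∑_σ d_σ ev_σ` vanishes on the range, so `∑_σ d_σ σ(x) = 0` for all `x ∈ k₁`, contradicting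
Dedekind's linear independence of the distinct embeddings `σ` (`linearIndependent_toLinearMap`).
[folklore] -/
theorem evalEmb_surjective [FiniteDimensional F k₁] : Function.Surjective (Algebra.TensorProduct.lift (Algebra.ofId E ((k₁ →ₐ[F] E) → E))
      (AlgHom.pi fun σ : k₁ →ₐ[F] E => σ) (fun _ _ => Commute.all _ _)) := by
  classical
  set P : E ⊗[F] k₁ →ₐ[E] ((k₁ →ₐ[F] E) → E) := (Algebra.TensorProduct.lift (Algebra.ofId E ((k₁ →ₐ[F] E) → E))
      (AlgHom.pi fun σ : k₁ →ₐ[F] E => σ) (fun _ _ => Commute.all _ _)) with hP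
  by_contra hsurj
  have hlt : LinearMap.range P.toLinearMap < ⊤ := by
    rw [lt_top_iff_ne_top]
    intro htop
    exact hsurj (LinearMap.range_eq_top.mp htop)
  obtain ⟨φ, hφ0, hφ⟩ := (LinearMap.range P.toLinearMap).exists_le_ker_of_lt_top hlt
  -- the coefficients of `φ`
  set d : (k₁ →ₐ[F] E) → E := fun σ => φ (Pi.single σ 1) with hd
  have hφd : ∀ v : (k₁ →ₐ[F] E) → E, φ v = ∑ σ, v σ * d σ := by
    intro v
    rw [LinearMap.pi_apply_eq_sum_univ φ v]
    refine Finset.sum_congr rfl fun σ _ => ?_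
    rw [smul_eq_mul]
    congr 1
    congr 1
    ext τ
    simp only [Pi.single_apply, eq_comm]
  -- `∑ d_σ σ = 0` as linear maps `k₁ → E`
  have hrel : ∑ σ : k₁ →ₐ[F] E, d σ • (σ : k₁ →ₐ[F] E).toLinearMap = 0 := by
    ext x
    have hx : φ (P ((1 : E) ⊗ₜ[F] x)) = 0 := by
      have hmem : P ((1 : E) ⊗ₜ[F] x) ∈ LinearMap.ker φ := hφ ⟨(1 : E) ⊗ₜ[F] x, rfl⟩
      exact hmem
    rw [hφd] at hx
    simp only [LinearMap.coe_sum, Finset.sum_apply, LinearMap.smul_apply, AlgHom.toLinearMap_apply,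
      smul_eq_mul, LinearMap.zero_apply]
    rw [← hx]
    refine Finset.sum_congr rfl fun σ _ => ?_
    rw [hP, evalEmb_tmul, one_mul, mul_comm]
  have hind := linearIndependent_toLinearMap F k₁ E
  have hd0 : ∀ σ, d σ = 0 := fun σ =>
    (Fintype.linearIndependent_iff.mp hind d hrel) σ
  apply hφ0
  refine LinearMap.ext fun v => ?_
  rw [hφd, LinearMap.zero_apply]
  simp only [hd0, mul_zero, Finset.sum_const_zero]

/-- **`(Algebra.TensorProduct.lift (Algebra.ofId E ((k₁ →ₐ[F] E) → E))
      (AlgHom.pi fun σ : k₁ →ₐ[F] E => σ) (fun _ _ => Commute.all _ _))` is injective when `E` contains all conjugates of `k₁`**, i.e. when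
`#Hom_F(k₁, E) = [k₁ : F]`: a surjective `E`-linear map between spaces of the same finite
dimension. [folklore] -/
theorem evalEmb_injective [FiniteDimensional F k₁]
    (hE : Fintype.card (k₁ →ₐ[F] E) = finrank F k₁) : Function.Injective (Algebra.TensorProduct.lift (Algebra.ofId E ((k₁ →ₐ[F] E) → E))
      (AlgHom.pi fun σ : k₁ →ₐ[F] E => σ) (fun _ _ => Commute.all _ _)) := by
  set P : E ⊗[F] k₁ →ₐ[E] ((k₁ →ₐ[F] E) → E) := (Algebra.TensorProduct.lift (Algebra.ofId E ((k₁ →ₐ[F] E) → E))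
      (AlgHom.pi fun σ : k₁ →ₐ[F] E => σ) (fun _ _ => Commute.all _ _)) with hP
  have hsurj : Function.Surjective P.toLinearMap := evalEmb_surjective
  have hdim : finrank E (E ⊗[F] k₁) = finrank E ((k₁ →ₐ[F] E) → E) := by
    rw [Module.finrank_baseChange, Module.finrank_fintype_fun_eq_card, hE]
  exact (LinearMap.injective_iff_surjective_of_finrank_eq_finrank hdim).mpr hsurj

/-- Under `Normal F E`, one `F`-embedding `j : k₁ → E` forces all of them into `E`:
`#Hom_F(k₁, E) = [k₁ : F]` (separability is automatic here only in characteristic zero, so it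
is assumed). [folklore] -/
theorem card_algHom_eq_finrank_of_normal [FiniteDimensional F k₁] [Algebra.IsSeparable F k₁]
    [Normal F E] (j : k₁ →ₐ[F] E) : Fintype.card (k₁ →ₐ[F] E) = finrank F k₁ := by
  refine AlgHom.card_of_splits F k₁ E fun x => ?_
  rw [← minpoly.algHom_eq j j.toRingHom.injective x]
  exact Normal.splits inferInstance (j x)

end Eval

section Sign

/-- **Odd sign functions.** A fixed-point-free involution `π` of a finite type `ι` admits
`ε : ι → R` with `ε i ∈ {1, -1}` (so `ε i * ε i = 1`) and `ε (π i) = - ε i`: number the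
elements and let `ε i = 1` iff `i` comes before `π i`. [folklore] -/
theorem exists_sign_of_involutive {ι : Type*} [Fintype ι] (R : Type*) [Ring R] (π : ι → ι)
    (hππ : ∀ i, π (π i) = i) (hπ : ∀ i, π i ≠ i) :
    ∃ ε : ι → R, (∀ i, ε i = 1 ∨ ε i = -1) ∧ (∀ i, ε i * ε i = 1) ∧ ∀ i, ε (π i) = -ε i := by
  classical
  let e : ι ≃ Fin (Fintype.card ι) := Fintype.equivFin ι
  refine ⟨fun i => if e i < e (π i) then 1 else -1, fun i => ?_, fun i => ?_, fun i => ?_⟩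
  · by_cases h : e i < e (π i)
    · exact Or.inl (if_pos h)
    · exact Or.inr (if_neg h)
  · by_cases h : e i < e (π i)
    · simp only [if_pos h, mul_one]
    · simp only [if_neg h, mul_neg, mul_one, neg_neg]
  · have hne : e i ≠ e (π i) := fun h => hπ i (e.injective h).symm
    simp only [hππ]
    by_cases h : e i < e (π i)
    · rw [if_pos h, if_neg (not_lt.mpr h.le)]
    · rw [if_neg h, if_pos (lt_of_le_of_ne (not_lt.mp h) (Ne.symm hne)), neg_neg]

end Sign

section Main

variable {F k₁ E : Type*} [Field F] [Field k₁] [Field E] [Algebra F k₁] [Algebra F E]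

/-- **Main theorem.** Let `c` be a non-trivial `F`-involution of the finite extension `k₁/F`
and suppose `E` contains all conjugates of `k₁` (`#Hom_F(k₁,E) = [k₁ : F]`). Then `E ⊗_F k₁`
contains `u` with `u² = 1` and `(1 ⊗ c) u = -u`. Proof: `σ ↦ σ ∘ c` is a fixed-point-free
involution of `Hom_F(k₁, E)`; take an odd sign function `ε` for it and `u := (Algebra.TensorProduct.lift (Algebra.ofId E ((k₁ →ₐ[F] E) → E))
      (AlgHom.pi fun σ : k₁ →ₐ[F] E => σ) (fun _ _ => Commute.all _ _))⁻¹ ε`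
(`(Algebra.TensorProduct.lift (Algebra.ofId E ((k₁ →ₐ[F] E) → E))
      (AlgHom.pi fun σ : k₁ →ₐ[F] E => σ) (fun _ _ => Commute.all _ _))` bijective). [folklore] -/
theorem exists_sq_eq_one_map_eq_neg [FiniteDimensional F k₁] (c : k₁ →ₐ[F] k₁)
    (hc : c ≠ AlgHom.id F k₁) (hcc : ∀ x, c (c x) = x)
    (hE : Fintype.card (k₁ →ₐ[F] E) = finrank F k₁) :
    ∃ u : E ⊗[F] k₁, u * u = 1 ∧ Algebra.TensorProduct.map (AlgHom.id E E) c u = -u := by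
  classical
  -- the free involution on embeddings
  have hππ : ∀ σ : k₁ →ₐ[F] E, (σ.comp c).comp c = σ := fun σ => by
    ext x; simp only [AlgHom.comp_apply, hcc]
  have hπ : ∀ σ : k₁ →ₐ[F] E, σ.comp c ≠ σ := by
    intro σ hσ
    apply hc
    ext x
    have h := AlgHom.congr_fun hσ x
    simp only [AlgHom.comp_apply] at h
    exact σ.toRingHom.injective h
  obtain ⟨ε, -, hε1, hεπ⟩ :=
    exists_sign_of_involutive E (fun σ : k₁ →ₐ[F] E => σ.comp c) hππ hπ
  have hinj : Function.Injective (Algebra.TensorProduct.lift (Algebra.ofId E ((k₁ →ₐ[F] E) → E))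
      (AlgHom.pi fun σ : k₁ →ₐ[F] E => σ) (fun _ _ => Commute.all _ _)) := evalEmb_injective hE
  obtain ⟨u, hu⟩ := (evalEmb_surjective (F := F) (k₁ := k₁) (E := E)) ε
  refine ⟨u, hinj ?_, hinj ?_⟩
  · rw [map_mul, map_one, hu]
    ext σ
    exact hε1 σ
  · rw [map_neg, hu]
    ext σ
    rw [evalEmb_map_conj, hu, Pi.neg_apply]
    exact hεπ σ

/-- **Main theorem, normal form.** If `E/F` is normal and receives one embedding of the finite
separable extension `k₁/F`, and `c` is a non-trivial `F`-involution of `k₁`, then `E ⊗_F k₁`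
contains `u` with `u² = 1`, `(1 ⊗ c) u = -u`. [folklore] -/
theorem exists_sq_eq_one_map_eq_neg_of_normal [FiniteDimensional F k₁] [Algebra.IsSeparable F k₁]
    [Normal F E] (j : k₁ →ₐ[F] E) (c : k₁ →ₐ[F] k₁) (hc : c ≠ AlgHom.id F k₁)
    (hcc : ∀ x, c (c x) = x) :
    ∃ u : E ⊗[F] k₁, u * u = 1 ∧ Algebra.TensorProduct.map (AlgHom.id E E) c u = -u :=
  exists_sq_eq_one_map_eq_neg c hc hcc (card_algHom_eq_finrank_of_normal j)

/-- **Push-forward along an intertwining embedding.** If `i : k₁ → K` is an `F`-algebra map into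
a commutative `F`-algebra `K` carrying an endomorphism `ρ` with `ρ ∘ i = i ∘ c`, then an element
`u ∈ E ⊗_F k₁` with `u² = 1`, `(1 ⊗ c) u = -u` maps to `u' ∈ E ⊗_F K` with `u'² = 1`,
`(1 ⊗ ρ) u' = -u'`. [folklore] -/
theorem sq_eq_one_map_eq_neg_push {K : Type*} [CommRing K] [Algebra F K] (i : k₁ →ₐ[F] K)
    (ρ : K →ₐ[F] K) (c : k₁ →ₐ[F] k₁) (hρi : ∀ x, ρ (i x) = i (c x)) {u : E ⊗[F] k₁}
    (hu : u * u = 1) (hcu : Algebra.TensorProduct.map (AlgHom.id E E) c u = -u) :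
    (Algebra.TensorProduct.map (AlgHom.id E E) i u) * (Algebra.TensorProduct.map (AlgHom.id E E) i u)
        = 1 ∧
      Algebra.TensorProduct.map (AlgHom.id E E) ρ (Algebra.TensorProduct.map (AlgHom.id E E) i u) =
        -Algebra.TensorProduct.map (AlgHom.id E E) i u := by
  refine ⟨by rw [← map_mul, hu, map_one], ?_⟩
  have hcomp : (Algebra.TensorProduct.map (AlgHom.id E E) ρ).comp
      (Algebra.TensorProduct.map (AlgHom.id E E) i) =
      (Algebra.TensorProduct.map (AlgHom.id E E) i).comp
        (Algebra.TensorProduct.map (AlgHom.id E E) c) := by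
    rw [← Algebra.TensorProduct.map_id_comp, ← Algebra.TensorProduct.map_id_comp]
    congr 1
    ext x
    simp only [AlgHom.comp_apply, hρi]
  have h := AlgHom.congr_fun hcomp u
  simp only [AlgHom.comp_apply] at h
  rw [h, hcu, map_neg]

/-- **Existence in `E ⊗_F K`.** For a commutative `F`-algebra `K` with endomorphism `ρ`
restricting, along some `i : k₁ →ₐ[F] K`, to a non-trivial involution `c` of a finite extension
`k₁/F` all of whose conjugates lie in `E`: there is `u ∈ E ⊗_F K` with `u² = 1` and
`(1 ⊗ ρ) u = -u`. [folklore] -/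
theorem exists_sq_eq_one_map_eq_neg_of_intertwines [FiniteDimensional F k₁] {K : Type*}
    [CommRing K] [Algebra F K] (i : k₁ →ₐ[F] K) (ρ : K →ₐ[F] K) (c : k₁ →ₐ[F] k₁)
    (hc : c ≠ AlgHom.id F k₁) (hcc : ∀ x, c (c x) = x) (hρi : ∀ x, ρ (i x) = i (c x))
    (hE : Fintype.card (k₁ →ₐ[F] E) = finrank F k₁) :
    ∃ u : E ⊗[F] K, u * u = 1 ∧ Algebra.TensorProduct.map (AlgHom.id E E) ρ u = -u := by
  obtain ⟨u, hu, hcu⟩ := exists_sq_eq_one_map_eq_neg (E := E) c hc hcc hE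
  exact ⟨_, sq_eq_one_map_eq_neg_push i ρ c hρi hu hcu⟩

end Main

end Summit.HodgeConjecture.CorCM.RMuNorm
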